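import Literature.Probability.Percolation.RingArcs
import HarnessLib

/-!
# Two arms closed up through an arc of the inner ring separate the rim from the deep hole

Topic `Literature/Probability/Percolation`; family `crit-perc`. The planar-topological lemma behind
the inner-boundary colour switching of `InnerFlipFourArm.lean` (P. Nolin, *Near-critical
percolation in two dimensions*, Electron. J. Probab. 13 (2008), §5.1 Prop. 20 [arXiv 0711.4948:
Prop. 19], the comparison of the two arrangements of four arms, here from a FIXED inner radius),
proved with winding numbers of lattice polylines (`TriLoopWinding.lean`, `SiteIfaceWinding.lean`)
instead of the Jordan curve theorem, exactly as the cycle arguments of Bollobás–Riordan,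
*Percolation* (2006), Ch. 7, Claims 7 and 9.

**The loop.** Two arms `P_A : p_A ⇝ y_A`, `P_B : p_B ⇝ y_B` of the annulus `{R ≤ |·| ≤ N}`, from
the rim `∂Λ_R` to the outer sphere `∂Λ_N`, an exterior walk `E` from `e_A ∼ y_A` to `e_B ∼ y_B`
through sites of norm `N + 1`, and an arc `rp (R-1) m₂, rp (R-1) (m₂ - 1), …, rp (R-1) m₁` of the
inner ring `∂Λ_{R-1}` (`rp` the periodic enumeration of `RingArcs.lean`, `m₁ ≤ m₂ < m₁ + 6(R-1)`)
hooked to `p_B` and `p_A` form a closed lattice polyline `C` (`SepLoop`, its points `pts`, its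
pieces `latPieces_eq`).

**The separation** (`SepLoop.W_ne`, `SepLoop.not_pathIn`). A rim site `b` off the two arms lying
"over" a bond `(rp (R-1) (i+1), rp (R-1) i)` of the arc — `b` is the outward apex `x` of that bond,
or `b` is adjacent to `x` and to one of its endpoints (the case of a rim corner, whose unique ring
neighbour is a corner of the ring) — and any site `q` of the deep hole `{|·| ≤ R - 2}` have
different winding numbers; hence every lattice path from `b` to `q` meets a vertex of `C`: a site
of one of the two arms, an exterior site, or a site of the arc. In the applications the arc passes
under `b` while the other two arms of a four-arm family reach the deep hole off the arc, which is
how the alternation of colours (the two separation clauses of `altFourArm`) is certified for arms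
starting on the inner boundary.

## References

* P. Nolin, *Near-critical percolation in two dimensions*, Electron. J. Probab. 13 (2008), §5.1
  Prop. 20 (arXiv 0711.4948: Prop. 19) [Nolin2008].
* B. Bollobás, O. Riordan, *Percolation*, CUP (2006), Ch. 7 §7.2.3, Claims 7 and 9, pp. 173–175
  [BollobasRiordan2006].

## Mathlib / tree

Tree: `rp`, `rp_adj'`, `rp_ne_rp_of_lt`, `triNorm_rp`, `exists_outFace_rp`, `eq_triLeftApex_or_of_adj`,
`mem_hexFaceVertices_oppFace_of_adj`, `triNorm_triLeftApex_rp_out` (`RingArcs.lean`); `latWind`,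
`latPieces`, `latWind_hexCenter_ne_of_side`, `latWind_hexCenter_eq_of_forall_not_side`,
`latWind_hexCenter_eq_latWind_faceVertex` (`TriLoopWinding.lean`); `latWind_triEmbed_eq_of_pathIn`,
`latWind_hexCenter_eq_of_mem_hexFaceVertices` (`SiteIfaceWinding.lean`);
`FourArmFlip.exists_walk_hole`, `FourArmFlip.pathIn_of_walk` (`FlipFourArm.lean`);
`consecPairs_map_range`, `head_map_range`, `getLast_map_range` (`SiteIfaceSector.lean`); `consecPairs`,
`mem_of_mem_consecPairs`, `consecPairs_append_of_ne_nil` (`CyclicPairs.lean`, `TriLoopWinding.lean`).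
-/

noncomputable section

open Finset Literature.Combinatorics.Enumerative

namespace Literature.Probability.Percolation

open LatticeModels
open TriMarkedDomain (fin3_add_one_add_one fin3_add_one_add_two fin3_add_two_add_one fin3_add_two_add_two
  adj_faceVertex_succ)

/-- **The data of a separating loop**: two arms of the annulus `{R ≤ |·| ≤ N}` from the rim to the
outer sphere, an exterior walk joining their outer tips, and an arc of the inner ring `∂Λ_{R-1}`
(indices `m₁ ≤ … ≤ m₂`, less than a period) hooked to their inner tips, with a distinguished bond
`(i+1, i)` of the arc. [cite: BollobasRiordan2006, Ch. 7 proof of Claim 7 p. 173] -/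
structure SepLoop where
  /-- the rim radius -/
  R : ℕ
  /-- the outer radius -/
  N : ℕ
  /-- inner tip of the first arm -/
  pA : Site 2
  /-- outer tip of the first arm -/
  yA : Site 2
  /-- inner tip of the second arm -/
  pB : Site 2
  /-- outer tip of the second arm -/
  yB : Site 2
  /-- start of the exterior walk -/
  eA : Site 2
  /-- end of the exterior walk -/
  eB : Site 2
  /-- the first arm -/
  PA : triGraph.Walk pA yA
  /-- the second arm -/
  PB : triGraph.Walk pB yB
  /-- the exterior walk -/
  E : triGraph.Walk eA eB
  /-- first index of the arc -/
  m₁ : ℕ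
  /-- last index of the arc -/
  m₂ : ℕ
  /-- the distinguished bond is `(i+1, i)` -/
  i : ℕ
  hR : 2 ≤ R
  hRN : R ≤ N
  hm₁ : m₁ ≤ i
  hi : i + 1 ≤ m₂
  hm₂ : m₂ < m₁ + 6 * (R - 1)
  PA_norm : ∀ z ∈ PA.support, (R : ℤ) ≤ triNorm z ∧ triNorm z ≤ N
  PB_norm : ∀ z ∈ PB.support, (R : ℤ) ≤ triNorm z ∧ triNorm z ≤ N
  E_norm : ∀ z ∈ E.support, triNorm z = N + 1
  adjA : triGraph.Adj yA eA
  adjB : triGraph.Adj eB yB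
  hopB : triGraph.Adj pB (rp (R - 1) m₂)
  hopA : triGraph.Adj (rp (R - 1) m₁) pA

namespace SepLoop

variable (C : SepLoop)

/-- The upper part of the arc, downwards: `rp m₂, rp (m₂ - 1), …, rp (i + 1)`. [folklore] -/
def arcHi : List (Site 2) := (List.range (C.m₂ - C.i - 1 + 1)).map fun t => rp (C.R - 1) (C.m₂ - t)

/-- The lower part of the arc, downwards: `rp i, …, rp m₁`. [folklore] -/
def arcLo : List (Site 2) := (List.range (C.i - C.m₁ + 1)).map fun t => rp (C.R - 1) (C.i - t)

/-- The points of the loop after `pA`: the first arm (without `pA`), the exterior walk, the second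
arm reversed, the arc downwards. [folklore] -/
def pts : List (Site 2) := C.PA.support.tail ++ C.E.support ++ C.PB.reverse.support ++ C.arcHi ++ C.arcLo

/-- **The winding number of the loop** about a point. [cite: BollobasRiordan2006, Ch. 7 proof of Claim 7 p. 173] -/
def W (p : ℂ) : ℤ := latWind C.pA C.pts p

/-- `1 ≤ R - 1`. [folklore] -/
theorem hR1 : 1 ≤ C.R - 1 := by have := C.hR; omega

/-- `arcHi` is nonempty. [folklore] -/
theorem arcHi_ne_nil : C.arcHi ≠ [] := by unfold arcHi; simp

/-- `arcLo` is nonempty. [folklore] -/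
theorem arcLo_ne_nil : C.arcLo ≠ [] := by unfold arcLo; simp

/-- The first site of `arcHi`. [folklore] -/
theorem arcHi_head : C.arcHi.head C.arcHi_ne_nil = rp (C.R - 1) C.m₂ := by
  unfold arcHi; rw [head_map_range]; rfl

/-- The last site of `arcHi`. [folklore] -/
theorem arcHi_getLast : C.arcHi.getLast C.arcHi_ne_nil = rp (C.R - 1) (C.i + 1) := by
  unfold arcHi; rw [getLast_map_range]; have := C.hi; congr 1; omega

/-- The first site of `arcLo`. [folklore] -/
theorem arcLo_head : C.arcLo.head C.arcLo_ne_nil = rp (C.R - 1) C.i := by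
  unfold arcLo; rw [head_map_range]; rfl

/-- The last site of `arcLo`. [folklore] -/
theorem arcLo_getLast : C.arcLo.getLast C.arcLo_ne_nil = rp (C.R - 1) C.m₁ := by
  unfold arcLo; rw [getLast_map_range]; have := C.hm₁; congr 1; omega

/-- Members of `arcHi` are arc sites with index in `[i + 1, m₂]`. [folklore] -/
theorem mem_arcHi_iff {x : Site 2} : x ∈ C.arcHi ↔ ∃ j, C.i + 1 ≤ j ∧ j ≤ C.m₂ ∧ rp (C.R - 1) j = x := by
  unfold arcHi
  simp only [List.mem_map, List.mem_range]
  have := C.hi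
  constructor
  · rintro ⟨t, ht, rfl⟩; exact ⟨C.m₂ - t, by omega, by omega, rfl⟩
  · rintro ⟨j, h1, h2, rfl⟩; exact ⟨C.m₂ - j, by omega, by congr 1; omega⟩

/-- Members of `arcLo` are arc sites with index in `[m₁, i]`. [folklore] -/
theorem mem_arcLo_iff {x : Site 2} : x ∈ C.arcLo ↔ ∃ j, C.m₁ ≤ j ∧ j ≤ C.i ∧ rp (C.R - 1) j = x := by
  unfold arcLo
  simp only [List.mem_map, List.mem_range]
  have := C.hm₁
  constructor
  · rintro ⟨t, ht, rfl⟩; exact ⟨C.i - t, by omega, by omega, rfl⟩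
  · rintro ⟨j, h1, h2, rfl⟩; exact ⟨C.i - j, by omega, by congr 1; omega⟩

/-- The consecutive pairs of `arcHi`: bonds `(rp (j+1), rp j)`, `i + 1 ≤ j < m₂`. [folklore] -/
theorem mem_consecPairs_arcHi {p : Site 2 × Site 2} (hp : p ∈ consecPairs C.arcHi) :
    ∃ j, C.i + 1 ≤ j ∧ j < C.m₂ ∧ p = (rp (C.R - 1) (j + 1), rp (C.R - 1) j) := by
  unfold arcHi at hp
  obtain ⟨t, ht, rfl⟩ := mem_consecPairs_map_range.1 hp
  have := C.hi
  exact ⟨C.m₂ - t - 1, by omega, by omega, Prod.ext (congrArg (rp (C.R - 1)) (by omega)) rfl⟩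

/-- The consecutive pairs of `arcLo`: bonds `(rp (j+1), rp j)`, `m₁ ≤ j < i`. [folklore] -/
theorem mem_consecPairs_arcLo {p : Site 2 × Site 2} (hp : p ∈ consecPairs C.arcLo) :
    ∃ j, C.m₁ ≤ j ∧ j < C.i ∧ p = (rp (C.R - 1) (j + 1), rp (C.R - 1) j) := by
  unfold arcLo at hp
  obtain ⟨t, ht, rfl⟩ := mem_consecPairs_map_range.1 hp
  have := C.hm₁
  exact ⟨C.i - t - 1, by omega, by omega, Prod.ext (congrArg (rp (C.R - 1)) (by omega)) rfl⟩

/-- The cyclic list of points of the loop. [folklore] -/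
theorem cons_pts_append : C.pA :: C.pts ++ [C.pA] =
    C.PA.support ++ (C.E.support ++ (C.PB.reverse.support ++ (C.arcHi ++ (C.arcLo ++ [C.pA])))) := by
  unfold pts
  rw [← C.PA.cons_tail_support]
  simp only [List.tail_cons, List.cons_append, List.append_assoc]

/-- **The pieces of the loop**: the bonds of `P_A`, the bond `(y_A, e_A)`, the bonds of `E`, the
bond `(e_B, y_B)`, the bonds of `P_B` reversed, the hop `(p_B, rp m₂)`, the bonds of the upper arc,
the distinguished bond `(rp (i+1), rp i)`, the bonds of the lower arc, and the hop `(rp m₁, p_A)`. [folklore] -/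
theorem latPieces_eq : latPieces C.pA C.pts =
    consecPairs C.PA.support ++ (C.yA, C.eA) :: (consecPairs C.E.support ++ (C.eB, C.yB) ::
      (consecPairs C.PB.reverse.support ++ (C.pB, rp (C.R - 1) C.m₂) :: (consecPairs C.arcHi ++
        (rp (C.R - 1) (C.i + 1), rp (C.R - 1) C.i) :: (consecPairs C.arcLo ++ [(rp (C.R - 1) C.m₁, C.pA)])))) := by
  rw [latPieces_eq_consecPairs, C.cons_pts_append,
    consecPairs_append_of_ne_nil _ _ (SimpleGraph.Walk.support_ne_nil _) (by simp),
    consecPairs_append_of_ne_nil _ _ (SimpleGraph.Walk.support_ne_nil _) (by simp),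
    consecPairs_append_of_ne_nil _ _ (SimpleGraph.Walk.support_ne_nil _) (by simp [C.arcHi_ne_nil]),
    consecPairs_append_of_ne_nil _ _ C.arcHi_ne_nil (by simp [C.arcLo_ne_nil]),
    consecPairs_append_of_ne_nil _ _ C.arcLo_ne_nil (by simp)]
  have h1 : (C.E.support ++ (C.PB.reverse.support ++ (C.arcHi ++ (C.arcLo ++ [C.pA])))).head (by simp) = C.eA := by
    rw [List.head_append_of_ne_nil (SimpleGraph.Walk.support_ne_nil _), SimpleGraph.Walk.head_support]
  have h2 : (C.PB.reverse.support ++ (C.arcHi ++ (C.arcLo ++ [C.pA]))).head (by simp) = C.yB := by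
    rw [List.head_append_of_ne_nil (SimpleGraph.Walk.support_ne_nil _), SimpleGraph.Walk.head_support]
  have h3 : (C.arcHi ++ (C.arcLo ++ [C.pA])).head (by simp [C.arcHi_ne_nil]) = rp (C.R - 1) C.m₂ := by
    rw [List.head_append_of_ne_nil C.arcHi_ne_nil, C.arcHi_head]
  have h4 : (C.arcLo ++ [C.pA]).head (by simp [C.arcLo_ne_nil]) = rp (C.R - 1) C.i := by
    rw [List.head_append_of_ne_nil C.arcLo_ne_nil, C.arcLo_head]
  simp only [SimpleGraph.Walk.getLast_support, consecPairs_singleton, List.head_cons, C.arcHi_getLast,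
    C.arcLo_getLast, h1, h2, h3, h4]

/-- The pieces other than the distinguished bond. [folklore] -/
def rest : List (Site 2 × Site 2) :=
  (consecPairs C.PA.support ++ (C.yA, C.eA) :: (consecPairs C.E.support ++ (C.eB, C.yB) ::
    (consecPairs C.PB.reverse.support ++ (C.pB, rp (C.R - 1) C.m₂) :: consecPairs C.arcHi))) ++
    (consecPairs C.arcLo ++ [(rp (C.R - 1) C.m₁, C.pA)])

/-- **The pieces with the distinguished bond singled out.** [folklore] -/
theorem latPieces_eq_mid : latPieces C.pA C.pts =
    (consecPairs C.PA.support ++ (C.yA, C.eA) :: (consecPairs C.E.support ++ (C.eB, C.yB) ::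
      (consecPairs C.PB.reverse.support ++ (C.pB, rp (C.R - 1) C.m₂) :: consecPairs C.arcHi))) ++
      (rp (C.R - 1) (C.i + 1), rp (C.R - 1) C.i) :: (consecPairs C.arcLo ++ [(rp (C.R - 1) C.m₁, C.pA)]) := by
  rw [C.latPieces_eq]; simp

/-- Membership in the pieces, case by case. [folklore] -/
theorem mem_latPieces {p : Site 2 × Site 2} (hp : p ∈ latPieces C.pA C.pts) :
    p ∈ consecPairs C.PA.support ∨ p = (C.yA, C.eA) ∨ p ∈ consecPairs C.E.support ∨ p = (C.eB, C.yB) ∨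
      p ∈ consecPairs C.PB.reverse.support ∨ p = (C.pB, rp (C.R - 1) C.m₂) ∨ p ∈ consecPairs C.arcHi ∨
      p = (rp (C.R - 1) (C.i + 1), rp (C.R - 1) C.i) ∨ p ∈ consecPairs C.arcLo ∨ p = (rp (C.R - 1) C.m₁, C.pA) := by
  rw [C.latPieces_eq] at hp
  simp only [List.mem_append, List.mem_cons, List.not_mem_nil, or_false] at hp
  tauto

/-- Members of `rest`, case by case. [folklore] -/
theorem mem_rest_cases {p : Site 2 × Site 2} (hp : p ∈ C.rest) :
    p ∈ consecPairs C.PA.support ∨ p = (C.yA, C.eA) ∨ p ∈ consecPairs C.E.support ∨ p = (C.eB, C.yB) ∨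
      p ∈ consecPairs C.PB.reverse.support ∨ p = (C.pB, rp (C.R - 1) C.m₂) ∨ p ∈ consecPairs C.arcHi ∨
      p ∈ consecPairs C.arcLo ∨ p = (rp (C.R - 1) C.m₁, C.pA) := by
  unfold rest at hp
  simp only [List.mem_append, List.mem_cons, List.not_mem_nil, or_false] at hp
  tauto

/-- Members of `rest` are pieces. [folklore] -/
theorem mem_latPieces_of_mem_rest {p : Site 2 × Site 2} (hp : p ∈ C.rest) : p ∈ latPieces C.pA C.pts := by
  rw [C.latPieces_eq_mid]
  unfold rest at hp
  simp only [List.mem_append, List.mem_cons] at hp ⊢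
  tauto

/-- The arc sites have norm `R - 1`. [folklore] -/
theorem triNorm_rp' (j : ℕ) : triNorm (rp (C.R - 1) j) = C.R - 1 := by
  rw [triNorm_rp C.hR1]; have := C.hR; omega

/-- `pB` has norm `R`: it lies in the annulus and is adjacent to a ring site. [folklore] -/
theorem triNorm_pB : triNorm C.pB = C.R := by
  have h1 := (C.PB_norm _ C.PB.start_mem_support).1
  have h2 := triNorm_le_triNorm_add_one_of_adj' C.hopB
  rw [C.triNorm_rp'] at h2
  omega

/-- `pA` has norm `R`. [folklore] -/
theorem triNorm_pA : triNorm C.pA = C.R := by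
  have h1 := (C.PA_norm _ C.PA.start_mem_support).1
  have h2 := triNorm_le_triNorm_add_one_of_adj C.hopA
  rw [C.triNorm_rp'] at h2
  omega

/-- `yA` has norm `N` (it lies in the annulus and is adjacent to an exterior site). [folklore] -/
theorem triNorm_yA : triNorm C.yA = C.N := by
  have h1 := (C.PA_norm _ C.PA.end_mem_support).2
  have h2 := triNorm_le_triNorm_add_one_of_adj C.adjA
  rw [C.E_norm _ C.E.start_mem_support] at h2
  omega

/-- `yB` has norm `N`. [folklore] -/
theorem triNorm_yB : triNorm C.yB = C.N := by
  have h1 := (C.PB_norm _ C.PB.end_mem_support).2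
  have h2 := triNorm_le_triNorm_add_one_of_adj' C.adjB
  rw [C.E_norm _ C.E.end_mem_support] at h2
  omega

/-- **Every piece of the loop is a bond.** [folklore] -/
theorem fst_eq_or_adj_of_mem_latPieces {p : Site 2 × Site 2} (hp : p ∈ latPieces C.pA C.pts) :
    p.1 = p.2 ∨ triGraph.Adj p.1 p.2 := by
  have hk := C.hR1
  rcases C.mem_latPieces hp with h | rfl | h | rfl | h | rfl | h | rfl | h | rfl
  · exact Or.inr (adj_of_mem_consecPairs_support _ h)
  · exact Or.inr C.adjA
  · exact Or.inr (adj_of_mem_consecPairs_support _ h)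
  · exact Or.inr C.adjB
  · exact Or.inr (adj_of_mem_consecPairs_support _ h)
  · exact Or.inr C.hopB
  · obtain ⟨j, -, -, rfl⟩ := C.mem_consecPairs_arcHi h
    exact Or.inr (rp_adj' hk j)
  · exact Or.inr (rp_adj' hk _)
  · obtain ⟨j, -, -, rfl⟩ := C.mem_consecPairs_arcLo h
    exact Or.inr (rp_adj' hk j)
  · exact Or.inr C.hopA

/-- **The vertices of the loop**: sites of the two arms, of the exterior walk, or arc sites with index
in `[m₁, m₂]`. [folklore] -/
theorem mem_cons_pts {v : Site 2} (hv : v ∈ C.pA :: C.pts) :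
    v ∈ C.PA.support ∨ v ∈ C.E.support ∨ v ∈ C.PB.support ∨ ∃ j, C.m₁ ≤ j ∧ j ≤ C.m₂ ∧ v = rp (C.R - 1) j := by
  unfold pts at hv
  have := C.hi; have := C.hm₁
  simp only [List.mem_cons, List.mem_append, SimpleGraph.Walk.support_reverse, List.mem_reverse, or_assoc] at hv
  rcases hv with rfl | hv | hv | hv | hv | hv
  · exact Or.inl C.PA.start_mem_support
  · exact Or.inl (List.mem_of_mem_tail hv)
  · exact Or.inr (Or.inl hv)
  · exact Or.inr (Or.inr (Or.inl hv))
  · obtain ⟨j, h1, h2, rfl⟩ := C.mem_arcHi_iff.1 hv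
    exact Or.inr (Or.inr (Or.inr ⟨j, by omega, h2, rfl⟩))
  · obtain ⟨j, h1, h2, rfl⟩ := C.mem_arcLo_iff.1 hv
    exact Or.inr (Or.inr (Or.inr ⟨j, h1, by omega, rfl⟩))

/-- **The norms of the vertices of the loop**: in `[R, N]` (arms), `N + 1` (exterior) or `R - 1` (arc). [folklore] -/
theorem triNorm_of_mem_cons_pts {v : Site 2} (hv : v ∈ C.pA :: C.pts) :
    ((C.R : ℤ) ≤ triNorm v ∧ triNorm v ≤ C.N) ∨ triNorm v = C.N + 1 ∨ triNorm v = C.R - 1 := by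
  rcases C.mem_cons_pts hv with h | h | h | ⟨j, -, -, rfl⟩
  · exact Or.inl (C.PA_norm _ h)
  · exact Or.inr (Or.inl (C.E_norm _ h))
  · exact Or.inl (C.PB_norm _ h)
  · exact Or.inr (Or.inr (C.triNorm_rp' j))

/-- Sites off the vertex list are off the pieces. [folklore] -/
theorem off_pieces {u : Site 2} (hu : u ∉ C.pA :: C.pts) : ∀ p ∈ latPieces C.pA C.pts, u ≠ p.1 ∧ u ≠ p.2 :=
  FourArmFlip.off_pieces_of_not_mem hu

/-- **Sites of the deep hole `{|·| ≤ R - 2}` are off the loop.** [folklore] -/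
theorem not_mem_of_deep {u : Site 2} (hu : triNorm u ≤ C.R - 2) : u ∉ C.pA :: C.pts := by
  intro h
  have := C.hR; have := C.hRN
  rcases C.triNorm_of_mem_cons_pts h with h | h | h <;> omega

/-- **Sites of the annulus off the two arms are off the loop.** [folklore] -/
theorem not_mem_of_ann {u : Site 2} (h1 : (C.R : ℤ) ≤ triNorm u) (h2 : triNorm u ≤ C.N) (hA : u ∉ C.PA.support)
    (hB : u ∉ C.PB.support) : u ∉ C.pA :: C.pts := by
  intro h
  have := C.hR; have := C.hRN
  rcases C.mem_cons_pts h with h | h | h | ⟨j, -, -, rfl⟩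
  · exact hA h
  · have := C.E_norm _ h; omega
  · exact hB h
  · rw [C.triNorm_rp'] at h1; omega

/-- **Ring sites off the arc are off the loop.** [folklore] -/
theorem not_mem_of_ring {u : Site 2} (hu : triNorm u = C.R - 1)
    (harc : ∀ j, C.m₁ ≤ j → j ≤ C.m₂ → u ≠ rp (C.R - 1) j) : u ∉ C.pA :: C.pts := by
  intro h
  have := C.hR; have := C.hRN
  rcases C.mem_cons_pts h with h | h | h | ⟨j, hj, hj', rfl⟩
  · have := (C.PA_norm _ h).1; omega
  · have := C.E_norm _ h; omega
  · have := (C.PB_norm _ h).1; omega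
  · exact harc j hj hj' rfl

/-- **No piece other than the distinguished bond has its two endpoints.** [folklore] -/
theorem ne_mid_of_mem_rest {p : Site 2 × Site 2} (hp : p ∈ C.rest) :
    ¬ ((p.1 = rp (C.R - 1) (C.i + 1) ∧ p.2 = rp (C.R - 1) C.i) ∨
      (p.1 = rp (C.R - 1) C.i ∧ p.2 = rp (C.R - 1) (C.i + 1))) := by
  have hk := C.hR1; have hR := C.hR; have hRN := C.hRN; have hi := C.hi; have hm₁ := C.hm₁; have hm₂ := C.hm₂
  have hnorm : ∀ j, triNorm (rp (C.R - 1) j) = C.R - 1 := C.triNorm_rp'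
  -- an endpoint of norm `≠ R - 1` rules out both alternatives
  have key1 : triNorm p.1 ≠ C.R - 1 → ¬ ((p.1 = rp (C.R - 1) (C.i + 1) ∧ p.2 = rp (C.R - 1) C.i) ∨
      (p.1 = rp (C.R - 1) C.i ∧ p.2 = rp (C.R - 1) (C.i + 1))) := by
    rintro hne (⟨h1, -⟩ | ⟨h1, -⟩) <;> exact hne (by rw [h1, hnorm])
  have key2 : triNorm p.2 ≠ C.R - 1 → ¬ ((p.1 = rp (C.R - 1) (C.i + 1) ∧ p.2 = rp (C.R - 1) C.i) ∨
      (p.1 = rp (C.R - 1) C.i ∧ p.2 = rp (C.R - 1) (C.i + 1))) := by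
    rintro hne (⟨-, h2⟩ | ⟨-, h2⟩) <;> exact hne (by rw [h2, hnorm])
  have hAK : ∀ x ∈ C.PA.support, triNorm x ≠ C.R - 1 := fun x hx => by have := (C.PA_norm x hx).1; omega
  have hBK : ∀ x ∈ C.PB.support, triNorm x ≠ C.R - 1 := fun x hx => by have := (C.PB_norm x hx).1; omega
  -- arc pieces: by injectivity of the enumeration on a window shorter than the period
  have harc : ∀ j, C.m₁ ≤ j → j < C.m₂ → j ≠ C.i →
      ¬ ((rp (C.R - 1) (j + 1) = rp (C.R - 1) (C.i + 1) ∧ rp (C.R - 1) j = rp (C.R - 1) C.i) ∨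
        (rp (C.R - 1) (j + 1) = rp (C.R - 1) C.i ∧ rp (C.R - 1) j = rp (C.R - 1) (C.i + 1))) := by
    rintro j hj hj' hne (⟨-, h2⟩ | ⟨h1, h2⟩)
    · rcases lt_or_gt_of_ne hne with hlt | hlt
      · exact rp_ne_rp_of_lt hk hlt (by omega) h2
      · exact rp_ne_rp_of_lt hk hlt (by omega) h2.symm
    · rcases lt_trichotomy (j + 1) C.i with hlt | heq | hlt
      · exact rp_ne_rp_of_lt hk hlt (by omega) h1
      · have h3 : rp (C.R - 1) j = rp (C.R - 1) (j + 2) := by rw [h2, ← heq]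
        exact rp_ne_rp_of_lt hk (by omega : j < j + 2) (by omega) h3
      · exact rp_ne_rp_of_lt hk hlt (by omega) h1.symm
  rcases C.mem_rest_cases hp with h | rfl | h | rfl | h | rfl | h | h | rfl
  · exact key1 (hAK _ (mem_of_mem_consecPairs h).1)
  · exact key1 (hAK _ C.PA.end_mem_support)
  · exact key1 (by rw [C.E_norm _ (mem_of_mem_consecPairs h).1]; omega)
  · exact key1 (by rw [C.E_norm _ C.E.end_mem_support]; omega)
  · refine key1 (hBK _ ?_)
    have := (mem_of_mem_consecPairs h).1
    rwa [SimpleGraph.Walk.support_reverse, List.mem_reverse] at this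
  · exact key1 (hBK _ C.PB.start_mem_support)
  · obtain ⟨j, hj, hj', rfl⟩ := C.mem_consecPairs_arcHi h
    exact harc j (by omega) hj' (by omega)
  · obtain ⟨j, hj, hj', rfl⟩ := C.mem_consecPairs_arcLo h
    exact harc j hj (by omega) (by omega)
  · exact key2 (by rw [C.triNorm_pA]; omega)

/-- Every piece is a bond (packaged hypothesis of the winding lemmas). [folklore] -/
theorem hadj_pieces : ∀ p ∈ latPieces C.pA C.pts, p.1 = p.2 ∨ triGraph.Adj p.1 p.2 :=
  fun _ hp => C.fst_eq_or_adj_of_mem_latPieces hp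

/-- **No piece joins a given ring site to a given rim site, except possibly the two hops.** [folklore] -/
theorem no_piece_ring_rim {u v : Site 2} (hu : triNorm u = C.R - 1) (hv : triNorm v = C.R)
    (h1 : ¬ (u = rp (C.R - 1) C.m₁ ∧ v = C.pA)) (h2 : ¬ (v = C.pB ∧ u = rp (C.R - 1) C.m₂)) :
    ∀ p ∈ latPieces C.pA C.pts, ¬ ((p.1 = u ∧ p.2 = v) ∨ (p.1 = v ∧ p.2 = u)) := by
  have hk := C.hR1; have hR := C.hR; have hRN := C.hRN; have hi := C.hi; have hm₁ := C.hm₁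
  have hnorm := C.triNorm_rp'
  have hAK : ∀ z ∈ C.PA.support, triNorm z ≠ C.R - 1 := fun z hz => by have := (C.PA_norm z hz).1; omega
  have hBK : ∀ z ∈ C.PB.support, triNorm z ≠ C.R - 1 := fun z hz => by have := (C.PB_norm z hz).1; omega
  have hEK : ∀ z ∈ C.E.support, triNorm z ≠ C.R - 1 := fun z hz => by have := C.E_norm z hz; omega
  -- a piece with both endpoints of norm `≠ R - 1`, or both of norm `R - 1`, is ruled out
  have out2 : ∀ p : Site 2 × Site 2, triNorm p.1 ≠ C.R - 1 → triNorm p.2 ≠ C.R - 1 →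
      ¬ ((p.1 = u ∧ p.2 = v) ∨ (p.1 = v ∧ p.2 = u)) := by
    rintro p hp1 hp2 (⟨e1, -⟩ | ⟨-, e2⟩)
    · exact hp1 (by rw [e1, hu])
    · exact hp2 (by rw [e2, hu])
  have in2 : ∀ p : Site 2 × Site 2, triNorm p.1 = C.R - 1 → triNorm p.2 = C.R - 1 →
      ¬ ((p.1 = u ∧ p.2 = v) ∨ (p.1 = v ∧ p.2 = u)) := by
    rintro p hp1 hp2 (⟨-, e2⟩ | ⟨e1, -⟩)
    · have := hp2; rw [e2, hv] at this; omega
    · have := hp1; rw [e1, hv] at this; omega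
  intro p hp
  rcases C.mem_latPieces hp with h | rfl | h | rfl | h | rfl | h | rfl | h | rfl
  · obtain ⟨m1, m2⟩ := mem_of_mem_consecPairs h
    exact out2 _ (hAK _ m1) (hAK _ m2)
  · exact out2 _ (hAK _ C.PA.end_mem_support) (hEK _ C.E.start_mem_support)
  · obtain ⟨m1, m2⟩ := mem_of_mem_consecPairs h
    exact out2 _ (hEK _ m1) (hEK _ m2)
  · exact out2 _ (hEK _ C.E.end_mem_support) (hBK _ C.PB.end_mem_support)
  · obtain ⟨m1, m2⟩ := mem_of_mem_consecPairs h
    rw [SimpleGraph.Walk.support_reverse, List.mem_reverse] at m1 m2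
    exact out2 _ (hBK _ m1) (hBK _ m2)
  · rintro (⟨e1, -⟩ | ⟨e1, e2⟩) <;> dsimp only at e1
    · exact hBK _ C.PB.start_mem_support (by rw [e1, hu])
    · dsimp only at e2; exact h2 ⟨e1.symm, e2.symm⟩
  · obtain ⟨j, -, -, rfl⟩ := C.mem_consecPairs_arcHi h
    exact in2 _ (hnorm _) (hnorm _)
  · exact in2 _ (hnorm _) (hnorm _)
  · obtain ⟨j, -, -, rfl⟩ := C.mem_consecPairs_arcLo h
    exact in2 _ (hnorm _) (hnorm _)
  · rintro (⟨e1, e2⟩ | ⟨-, e2⟩) <;> dsimp only at e2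
    · dsimp only at e1; exact h1 ⟨e1.symm, e2.symm⟩
    · exact hAK _ C.PA.start_mem_support (by rw [e2, hu])

set_option maxHeartbeats 800000 in
/-- **The separation.** Let `x` be the outward apex of the distinguished bond (the site of norm `R`
adjacent to `rp (R-1) i` and `rp (R-1) (i+1)`) and let `b` be a rim site off the two arms which is
`x` itself, or is adjacent to `x` and to `rp (R-1) i` (resp. `rp (R-1) (i+1)`) — then the side
`(rp i, x)` (resp. `(rp (i+1), x)`) must not be a hop of the loop. Then the winding numbers of the
loop about `b` and about any site `q` of the deep hole `{|·| ≤ R - 2}` differ: `b` sees the outward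
face of the distinguished bond, `q` the inward one (Bollobás–Riordan 2006, Claim 7: the two faces
across an edge of the cycle traversed once). [cite: BollobasRiordan2006, Ch. 7 proof of Claims 7 and 9 pp. 173–175] -/
theorem W_ne {x b q : Site 2} (hx : triNorm x = C.R) (hx₁ : triGraph.Adj x (rp (C.R - 1) C.i))
    (hx₂ : triGraph.Adj x (rp (C.R - 1) (C.i + 1)))
    (hbR : triNorm b = C.R) (hbA : b ∉ C.PA.support) (hbB : b ∉ C.PB.support)
    (hcase : b = x ∨ (triGraph.Adj b x ∧ triGraph.Adj b (rp (C.R - 1) C.i) ∧ ¬ (C.i = C.m₁ ∧ x = C.pA)) ∨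
      (triGraph.Adj b x ∧ triGraph.Adj b (rp (C.R - 1) (C.i + 1)) ∧ ¬ (C.i + 1 = C.m₂ ∧ x = C.pB)))
    (hq : triNorm q ≤ C.R - 2) : C.W (triEmbed b) ≠ C.W (triEmbed q) := by
  have hk := C.hR1; have hR := C.hR; have hRN := C.hRN; have hi := C.hi; have hm₁ := C.hm₁; have hm₂ := C.hm₂
  have hadj := C.hadj_pieces
  have hnorm := C.triNorm_rp'
  -- the outward face `F` of the distinguished bond; `x` is its apex
  obtain ⟨F, j, hFj, hFj1, hFj2, hin⟩ := exists_outFace_rp hk C.i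
  have hxF : x = faceVertex F (j + 2) := by
    rcases eq_triLeftApex_or_of_adj (rp_adj hk C.i) hx₁ hx₂ with h | h
    · exfalso
      have := triNorm_triLeftApex_rp_in hk C.i
      rw [← h, hx] at this; omega
    · rw [h, ← triLeftApex_faceVertex F j, hFj, hFj1]
  -- `b` is off the loop
  have hboff : b ∉ C.pA :: C.pts := C.not_mem_of_ann (by rw [hbR]) (by rw [hbR]; exact_mod_cast hRN) hbA hbB
  have hbpc := C.off_pieces hboff
  -- (1) the winding about `b` is that of `F`
  have h1 : C.W (triEmbed b) = latWind C.pA C.pts (hexCenter F) := by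
    rcases hcase with rfl | ⟨hbx, hbi, hne⟩ | ⟨hbx, hbi, hne⟩
    · rw [hxF]; exact (latWind_hexCenter_eq_latWind_faceVertex hadj (by rw [← hxF]; exact hbpc)).symm
    · -- across the side `j` = `(rp i, x)`
      have hside : latWind C.pA C.pts (hexCenter F) = latWind C.pA C.pts (hexCenter (oppFace F j)) := by
        refine latWind_hexCenter_eq_of_forall_not_side hadj fun p hp => ?_
        rw [hFj1, ← hxF]
        refine C.no_piece_ring_rim (hnorm _) hx (fun ⟨e1, e2⟩ => hne ⟨?_, e2⟩) (fun ⟨e1, e2⟩ => ?_) p hp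
        · by_contra hne'
          exact rp_ne_rp_of_lt hk (lt_of_le_of_ne hm₁ (Ne.symm hne')) (by omega) e1.symm
        · exact rp_ne_rp_of_lt hk (by omega : C.i < C.m₂) (by omega) e2
      have hmem : b ∈ hexFaceVertices (oppFace F j) :=
        mem_hexFaceVertices_oppFace_of_adj (by rw [hFj1]; exact hbi) (by rw [← hxF]; exact hbx)
          (by rw [hFj]; intro e; have := hnorm (C.i + 1); rw [← e, hbR] at this; omega)
      rw [hside]; exact (latWind_hexCenter_eq_of_mem_hexFaceVertices hadj hmem hbpc).symm
    · -- across the side `j + 1` = `(x, rp (i+1))`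
      have hside : latWind C.pA C.pts (hexCenter F) = latWind C.pA C.pts (hexCenter (oppFace F (j + 1))) := by
        refine latWind_hexCenter_eq_of_forall_not_side hadj fun p hp => ?_
        rw [fin3_add_one_add_one, fin3_add_one_add_two, hFj, ← hxF]
        have key := C.no_piece_ring_rim (u := rp (C.R - 1) (C.i + 1)) (v := x) (hnorm _) hx (fun ⟨e1, e2⟩ => ?_)
          (fun ⟨e1, e2⟩ => hne ⟨?_, e1⟩) p hp
        · exact fun h => key (h.symm)
        · exact rp_ne_rp_of_lt hk (by omega : C.m₁ < C.i + 1) (by omega) e1.symm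
        · by_contra hne'
          exact rp_ne_rp_of_lt hk (lt_of_le_of_ne hi hne') (by omega) e2
      have hmem : b ∈ hexFaceVertices (oppFace F (j + 1)) :=
        mem_hexFaceVertices_oppFace_of_adj (by rw [fin3_add_one_add_one, ← hxF]; exact hbx)
          (by rw [fin3_add_one_add_two, hFj]; exact hbi)
          (by rw [hFj1]; intro e; have := hnorm C.i; rw [← e, hbR] at this; omega)
      rw [hside]; exact (latWind_hexCenter_eq_of_mem_hexFaceVertices hadj hmem hbpc).symm
  -- (2) the windings of `F` and of the inward face differ
  have h2 : latWind C.pA C.pts (hexCenter F) ≠ latWind C.pA C.pts (hexCenter (oppFace F (j + 2))) := by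
    refine latWind_hexCenter_ne_of_side hadj
      (L₁ := consecPairs C.PA.support ++ (C.yA, C.eA) :: (consecPairs C.E.support ++ (C.eB, C.yB) ::
        (consecPairs C.PB.reverse.support ++ (C.pB, rp (C.R - 1) C.m₂) :: consecPairs C.arcHi)))
      (L₂ := consecPairs C.arcLo ++ [(rp (C.R - 1) C.m₁, C.pA)]) (Or.inl ?_) fun p hp => ?_
    · rw [fin3_add_two_add_one, fin3_add_two_add_two, hFj, hFj1]; exact C.latPieces_eq_mid
    · rw [fin3_add_two_add_one, fin3_add_two_add_two, hFj, hFj1]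
      exact C.ne_mid_of_mem_rest (by unfold SepLoop.rest; exact hp)
  -- (3) the winding of the inward face is that of the deep hole
  set y := faceVertex (oppFace F (j + 2)) (oppIdx F (j + 2)) with hy
  have hyR : triNorm y ≤ C.R - 2 := by rw [hin]; omega
  have h3 : latWind C.pA C.pts (hexCenter (oppFace F (j + 2))) = C.W (triEmbed y) :=
    latWind_hexCenter_eq_latWind_faceVertex hadj (C.off_pieces (C.not_mem_of_deep hyR))
  have h4 : C.W (triEmbed y) = C.W (triEmbed q) := by
    obtain ⟨H, hH⟩ := FourArmFlip.exists_walk_hole (n := C.R - 1) (d := y) (d' := q) (by omega) (by omega)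
    exact latWind_triEmbed_eq_of_walk hadj H fun z hz => C.off_pieces (C.not_mem_of_deep (by have := hH z hz; omega))
  rw [h1, ← h4, ← h3]
  exact h2

/-- **Corollary: every path from `b` to the deep hole meets the loop** — its vertices being the sites
of the two arms, the exterior sites, and the arc sites `rp (R-1) j`, `m₁ ≤ j ≤ m₂`. [cite: BollobasRiordan2006, Ch. 7 proof of Claim 9 p. 175] -/
theorem not_pathIn {x b q : Site 2} (hx : triNorm x = C.R) (hx₁ : triGraph.Adj x (rp (C.R - 1) C.i))
    (hx₂ : triGraph.Adj x (rp (C.R - 1) (C.i + 1)))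
    (hbR : triNorm b = C.R) (hbA : b ∉ C.PA.support) (hbB : b ∉ C.PB.support)
    (hcase : b = x ∨ (triGraph.Adj b x ∧ triGraph.Adj b (rp (C.R - 1) C.i) ∧ ¬ (C.i = C.m₁ ∧ x = C.pA)) ∨
      (triGraph.Adj b x ∧ triGraph.Adj b (rp (C.R - 1) (C.i + 1)) ∧ ¬ (C.i + 1 = C.m₂ ∧ x = C.pB)))
    (hq : triNorm q ≤ C.R - 2) {S : Set (Site 2)} (hS : ∀ z ∈ S, z ∉ C.pA :: C.pts) :
    ¬ PathIn triGraph S b q := fun h =>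
  C.W_ne hx hx₁ hx₂ hbR hbA hbB hcase hq
    (latWind_triEmbed_eq_of_pathIn C.hadj_pieces (fun z hz => C.off_pieces (hS z hz)) h)

end SepLoop

end Literature.Probability.Percolation

end
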